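import Summits.AtomisticToContinuum.FouriersLaw.Theses.OddSectorIrreversibility
import Summits.AtomisticToContinuum.FouriersLaw.Theses.TransferKernelPositivity
import Summits.AtomisticToContinuum.FouriersLaw.Theses.JunctionLocality
import Summits.AtomisticToContinuum.FouriersLaw.Theses.BoundaryEscapeDeficit
import Summits.AtomisticToContinuum.FouriersLaw.Theorems.OddSectorIrreversibilityBoundedResponseConvergesSplit

/-!
# Strategist s2 — typed companion of `STRATEGY-CENSUS.md` for crux stmt-AtomisticToContinuum-9141
`OddSectorIrreversibility.BoundedResponseConverges` (twins: `TransferKernelPositivity`, `LocalOhmBV`,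
`MatthiessenLadder`).

planner-cstrat-stmt-AtomisticToContinuum-9141-s2-0, 2026-08-17. Everything here is sorry-free.

* §1 A discrete Schmidt-type Tauberian theorem: Cesàro convergence + slow oscillation (dilation
  windows `[n, n + n/k]`) ⇒ convergence (`tendsto_of_cesaro_of_slowlyOscillating`), and the two
  trivial converses.
* §2 The TAUBERIAN SPLIT of the crux (census §Decomposition, entry D-2): frame-level statements
  `CesaroResponse`, `SlowlyOscillatingResponse`; composition
  `boundedResponseConverges_of_tauberian : CesaroResponse → SlowlyOscillatingResponse →
  JunctionLocality.ConductanceLowerBound → BoundedResponseConverges` (the crux's `BddAbove` is idle);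
  NECESSITY of both new pieces modulo `BoundedResponse` (stmt-10924):
  `cesaroResponse_of_boundedResponseConverges`, `slowlyOscillatingResponse_of_boundedResponseConverges`.
  Unlike the registered strengthenings (U) / Kubo ladder / (S23), which Fourier's own conclusion does
  NOT imply (`Theorems/BoundedResponseConverges/Negative/TwoScaleKillCriteria.lean`), these pieces are
  consequences of the crux: an exact 3-piece refinement of the oscillation child (stmt-12238).
  NOT registered as a line (no engine for either piece — see the census).
* §3 Twin transport: the split glue for the `TransferKernelPositivity` twin (bet route), one line over
  the landed `boundedResponseConverges_of_subs` (p137843).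
-/

open Filter Topology

namespace Summit.AtomisticToContinuum.FouriersLaw.Cruxes.BoundedResponseConverges.StrategistS2

/-! ## §1 Cesàro + slow oscillation ⇒ convergence -/

/-- Slow oscillation of a real sequence, with dilation windows `[n, n + n/k]` (`λ = 1 + 1/k`). -/
def SlowlyOscillating (D : ℕ → ℝ) : Prop :=
  ∀ ε : ℝ, 0 < ε → ∃ k : ℕ, 0 < k ∧ ∃ N₀ : ℕ, ∀ n m : ℕ, N₀ ≤ n → n ≤ m → m ≤ n + n / k →
    |D m - D n| ≤ ε

/-- Cesàro means `(D 0 + … + D (N-1)) / N`. -/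
noncomputable def cesaro (D : ℕ → ℝ) (N : ℕ) : ℝ := (∑ n ∈ Finset.range N, D n) / (N : ℝ)

theorem cesaro_neg (D : ℕ → ℝ) (N : ℕ) : cesaro (fun n => -D n) N = -cesaro D N := by
  simp [cesaro, Finset.sum_neg_distrib, neg_div]

theorem slowlyOscillating_neg {D : ℕ → ℝ} (h : SlowlyOscillating D) :
    SlowlyOscillating (fun n => -D n) := by
  intro ε hε
  obtain ⟨k, hk, N₀, hN⟩ := h ε hε
  refine ⟨k, hk, N₀, fun n m hn hnm hm => ?_⟩
  have h1 := hN n m hn hnm hm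
  calc |(-D m) - (-D n)| = |D m - D n| := by
        rw [← abs_neg]; congr 1; ring
    _ ≤ ε := h1

/-- A convergent sequence is slowly oscillating (Cauchy). -/
theorem slowlyOscillating_of_tendsto {D : ℕ → ℝ} {s : ℝ} (h : Tendsto D atTop (𝓝 s)) :
    SlowlyOscillating D := by
  intro ε hε
  obtain ⟨N₀, hN₀⟩ := Metric.tendsto_atTop.mp h (ε / 2) (half_pos hε)
  refine ⟨1, one_pos, N₀, fun n m hn hnm _ => ?_⟩
  have h1 := hN₀ n hn
  have h2 := hN₀ m (le_trans hn hnm)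
  rw [Real.dist_eq] at h1 h2
  calc |D m - D n| = |(D m - s) - (D n - s)| := by ring_nf
    _ ≤ |D m - s| + |D n - s| := abs_sub _ _
    _ ≤ ε := by linarith

/-- The Cesàro means of a convergent sequence converge to the same limit (Mathlib). -/
theorem cesaro_tendsto_of_tendsto {D : ℕ → ℝ} {s : ℝ} (h : Tendsto D atTop (𝓝 s)) :
    Tendsto (cesaro D) atTop (𝓝 s) := by
  have h1 := h.cesaro
  refine h1.congr' (Eventually.of_forall fun N => ?_)
  simp [cesaro, div_eq_inv_mul]

/-- One-sided core of the Tauberian theorem: eventually `D n ≤ s + ε`. -/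
theorem eventually_le_of_cesaro_of_slowlyOscillating {D : ℕ → ℝ} {s : ℝ}
    (hC : Tendsto (cesaro D) atTop (𝓝 s)) (hSO : SlowlyOscillating D) {ε : ℝ} (hε : 0 < ε) :
    ∀ᶠ n in atTop, D n ≤ s + ε := by
  obtain ⟨k, hk, N₀, hN⟩ := hSO (ε / 2) (half_pos hε)
  have hkR : (0 : ℝ) < k := by exact_mod_cast hk
  set δ : ℝ := ε / (16 * k) with hδ
  have hδpos : 0 < δ := by rw [hδ]; positivity
  have hδk : δ * (16 * k) = ε := by rw [hδ]; field_simp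
  obtain ⟨N₁, hN₁⟩ := Metric.tendsto_atTop.mp hC δ hδpos
  refine eventually_atTop.2 ⟨max (max N₀ N₁) (2 * k), fun n hn => ?_⟩
  have hnN₀ : N₀ ≤ n := le_trans (le_trans (le_max_left _ _) (le_max_left _ _)) hn
  have hnN₁ : N₁ ≤ n := le_trans (le_trans (le_max_right _ _) (le_max_left _ _)) hn
  have hn2k : 2 * k ≤ n := le_trans (le_max_right _ _) hn
  refine not_lt.mp fun hcon => ?_
  -- the window `[n, n + W)`, `W = n / k`
  set W : ℕ := n / k with hW
  set M : ℕ := n + W with hM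
  have hnM : n ≤ M := Nat.le_add_right n W
  have hwin : ∀ m ∈ Finset.Ico n M, s + ε / 2 ≤ D m := by
    intro m hm
    rw [Finset.mem_Ico] at hm
    have h1 := hN n m hnN₀ hm.1 (by omega)
    have h2 := (abs_le.mp h1).1
    linarith
  -- sums over `range n`, `Ico n M`, `range M`
  have hsum : (∑ i ∈ Finset.range M, D i) =
      (∑ i ∈ Finset.range n, D i) + ∑ i ∈ Finset.Ico n M, D i :=
    (Finset.sum_range_add_sum_Ico D hnM).symm
  have hIco : ((M - n : ℕ) : ℝ) * (s + ε / 2) ≤ ∑ i ∈ Finset.Ico n M, D i := by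
    have h1 := Finset.card_nsmul_le_sum (Finset.Ico n M) D (s + ε / 2) hwin
    rwa [Nat.card_Ico, nsmul_eq_mul] at h1
  have hMn : ((M - n : ℕ) : ℝ) = (W : ℝ) := by
    have : M - n = W := by omega
    rw [this]
  rw [hMn] at hIco
  -- Cesàro accuracy at `n` and at `M`
  have hnpos : 0 < n := by omega
  have hnR : (0 : ℝ) < n := by exact_mod_cast hnpos
  have hMpos : 0 < M := by omega
  have hMR : (0 : ℝ) < M := by exact_mod_cast hMpos
  have hCn := hN₁ n hnN₁
  have hCM := hN₁ M (by omega)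
  rw [Real.dist_eq] at hCn hCM
  unfold cesaro at hCn hCM
  have hSn : (s - δ) * n < ∑ i ∈ Finset.range n, D i := by
    have h1 : s - δ < (∑ i ∈ Finset.range n, D i) / n := by linarith [(abs_lt.mp hCn).1]
    exact (lt_div_iff₀ hnR).mp h1
  have hSM : (∑ i ∈ Finset.range M, D i) < (s + δ) * M := by
    have h1 : (∑ i ∈ Finset.range M, D i) / M < s + δ := by linarith [(abs_lt.mp hCM).2]
    exact (div_lt_iff₀ hMR).mp h1
  -- arithmetic: `M = n + W`, `k * W > n - k ≥ n / 2`, `W ≤ n`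
  have hMR' : (M : ℝ) = n + W := by rw [hM]; push_cast; ring
  have hWR : (0 : ℝ) ≤ W := by exact_mod_cast Nat.zero_le W
  have hdiv : (k : ℝ) * W = n - (n % k : ℕ) := by
    have h1 : k * W + n % k = n := by rw [hW]; exact Nat.div_add_mod n k
    have h2 : ((k * W + n % k : ℕ) : ℝ) = (n : ℝ) := by exact_mod_cast h1
    push_cast at h2
    linarith
  have hmod : ((n % k : ℕ) : ℝ) ≤ k - 1 := by
    have h1 : n % k < k := Nat.mod_lt n hk
    have h2 : n % k + 1 ≤ k := h1
    have h3 : ((n % k + 1 : ℕ) : ℝ) ≤ (k : ℝ) := by exact_mod_cast h2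
    push_cast at h3
    linarith
  have h2kR : 2 * (k : ℝ) ≤ n := by exact_mod_cast hn2k
  have hWn : (W : ℝ) ≤ n := by
    have h1 : W ≤ n := by rw [hW]; exact Nat.div_le_self n k
    exact_mod_cast h1
  -- step 1: `2δn + δW > εW/2`
  have step1 : ε * W / 2 < 2 * δ * n + δ * W := by
    have e2 : (W : ℝ) * (s + ε / 2) = s * W + ε * W / 2 := by ring
    have e3 : (s - δ) * (n : ℝ) = s * n - δ * n := by ring
    have e4 : (s + δ) * (M : ℝ) = s * n + δ * n + s * W + δ * W := by rw [hMR']; ring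
    rw [e2] at hIco
    rw [e3] at hSn
    rw [e4] at hSM
    linarith
  -- step 2: `3δn > εW/2`
  have step2 : ε * W / 2 < 3 * δ * n := by
    have h1 : δ * (W : ℝ) ≤ δ * n := mul_le_mul_of_nonneg_left hWn hδpos.le
    linarith
  -- step 3: `2kW > n`
  have step3 : (n : ℝ) < 2 * k * W := by nlinarith
  -- step 4: contradiction
  have h4 : ε * (n : ℝ) < ε * (2 * k * W) := mul_lt_mul_of_pos_left step3 hε
  have h5 : 2 * (k : ℝ) * (ε * W) < 2 * k * (6 * δ * n) :=
    mul_lt_mul_of_pos_left (by linarith) (by positivity)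
  have h6 : ε * (n : ℝ) < 12 * k * δ * n := by nlinarith
  rw [← hδk] at h6
  nlinarith [mul_pos (mul_pos hδpos hkR) hnR]

/-- **Discrete Schmidt Tauberian theorem.** If the Cesàro means of `D` converge to `s` and `D` is
slowly oscillating, then `D n → s`. -/
theorem tendsto_of_cesaro_of_slowlyOscillating {D : ℕ → ℝ} {s : ℝ}
    (hC : Tendsto (cesaro D) atTop (𝓝 s)) (hSO : SlowlyOscillating D) :
    Tendsto D atTop (𝓝 s) := by
  rw [Metric.tendsto_atTop]
  intro ε hε
  have hup := eventually_le_of_cesaro_of_slowlyOscillating hC hSO (half_pos hε)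
  have hCneg : Tendsto (cesaro (fun n => -D n)) atTop (𝓝 (-s)) := by
    have h1 : cesaro (fun n => -D n) = fun N => -cesaro D N := funext (cesaro_neg D)
    rw [h1]
    exact hC.neg
  have hlow := eventually_le_of_cesaro_of_slowlyOscillating hCneg (slowlyOscillating_neg hSO)
    (half_pos hε)
  obtain ⟨N, hN⟩ := eventually_atTop.1 (hup.and hlow)
  refine ⟨N, fun n hn => ?_⟩
  obtain ⟨h1, h2⟩ := hN n hn
  rw [Real.dist_eq, abs_lt]
  constructor <;> linarith

/-! ## §2 The Tauberian split of the crux (typed; composition and necessity proved) -/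

open Summit.AtomisticToContinuum.FouriersLaw.Theses

/-- CESÀRO RESPONSE (frame of the crux): along every steady-state family and `T > 0`, the Cesàro
means of the response coefficients `D_N` converge. Necessary for the crux modulo `BoundedResponse`;
no engine known (census D-2). -/
def CesaroResponse : Prop :=
  ∀ ω₂ lam β γ : ℝ, 0 < ω₂ → 0 < lam → 0 < β → 0 < γ → (∀ (N : ℕ) (T_L T_R : ℝ), 0 < T_L → 0 < T_R → ∀ μ ν : MeasureTheory.Measure (Literature.MathematicalPhysics.KineticTheory.HeatConduction.PhaseSpace N), (Literature.MathematicalPhysics.KineticTheory.HeatConduction.pinnedChain ω₂ lam β γ).IsSteadyState N T_L T_R μ → (Literature.MathematicalPhysics.KineticTheory.HeatConduction.pinnedChain ω₂ lam β γ).IsSteadyState N T_L T_R ν → μ = ν) → ∀ μ : (N : ℕ) → ℝ → ℝ → MeasureTheory.Measure (Literature.MathematicalPhysics.KineticTheory.HeatConduction.PhaseSpace N), (∀ (N : ℕ) (T_L T_R : ℝ), 0 < T_L → 0 < T_R → (Literature.MathematicalPhysics.KineticTheory.HeatConduction.pinnedChain ω₂ lam β γ).IsSteadyState N T_L T_R (μ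 N T_L T_R)) → ∀ T : ℝ, 0 < T → ∀ D : ℕ → ℝ, (∀ N : ℕ, Filter.Tendsto (fun δ : ℝ => (Literature.MathematicalPhysics.KineticTheory.HeatConduction.pinnedChain ω₂ lam β γ).totalCurrent (μ N (T + δ / 2) (T - δ / 2)) / δ) (nhdsWithin 0 {(0 : ℝ)}ᶜ) (nhds (D N))) → ∃ s : ℝ, Filter.Tendsto (fun N : ℕ => (∑ n ∈ Finset.range N, D n) / (N : ℝ)) Filter.atTop (nhds s)

/-- SLOWLY OSCILLATING RESPONSE (frame of the crux): `|D_M − D_N| ≤ ε` for `N₀ ≤ N ≤ M ≤ N + N/k`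
("chains of comparable length conduct alike"). Necessary for the crux modulo `BoundedResponse`; its
natural proof is late-time tail control of the boundary autocorrelation across comparable lengths,
i.e. the content of `BoundaryEscapeDeficit.DiffusiveCrossover` (stmt-12236) — no engine (census D-2). -/
def SlowlyOscillatingResponse : Prop :=
  ∀ ω₂ lam β γ : ℝ, 0 < ω₂ → 0 < lam → 0 < β → 0 < γ → (∀ (N : ℕ) (T_L T_R : ℝ), 0 < T_L → 0 < T_R → ∀ μ ν : MeasureTheory.Measure (Literature.MathematicalPhysics.KineticTheory.HeatConduction.PhaseSpace N), (Literature.MathematicalPhysics.KineticTheory.HeatConduction.pinnedChain ω₂ lam β γ).IsSteadyState N T_L T_R μ → (Literature.MathematicalPhysics.KineticTheory.HeatConduction.pinnedChain ω₂ lam β γ).IsSteadyState N T_L T_R ν → μ = ν) → ∀ μ : (N : ℕ) → ℝ → ℝ → MeasureTheory.Measure (Literature.MathematicalPhysics.KineticTheory.HeatConduction.PhaseSpace N), (∀ (N : ℕ) (T_L T_R : ℝ), 0 < T_L → 0 < T_R → (Literature.MathematicalPhysics.KineticTheory.HeatConduction.pinnedChain ω₂ lam β γ).IsSteadyState N T_L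 T_R (μ N T_L T_R)) → ∀ T : ℝ, 0 < T → ∀ D : ℕ → ℝ, (∀ N : ℕ, Filter.Tendsto (fun δ : ℝ => (Literature.MathematicalPhysics.KineticTheory.HeatConduction.pinnedChain ω₂ lam β γ).totalCurrent (μ N (T + δ / 2) (T - δ / 2)) / δ) (nhdsWithin 0 {(0 : ℝ)}ᶜ) (nhds (D N))) → ∀ ε : ℝ, 0 < ε → ∃ k : ℕ, 0 < k ∧ ∃ N₀ : ℕ, ∀ n m : ℕ, N₀ ≤ n → n ≤ m → m ≤ n + n / k → |D m - D n| ≤ ε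

/-- COMPOSITION of the Tauberian split: Cesàro response + slow oscillation + the conductance floor
(stmt-11749) give the crux — the crux's own `BddAbove` hypothesis is not even used. -/
theorem boundedResponseConverges_of_tauberian :
    CesaroResponse → SlowlyOscillatingResponse → JunctionLocality.ConductanceLowerBound →
      OddSectorIrreversibility.BoundedResponseConverges := by
  intro hC hSO hF ω₂ lam β γ hω hl hβ hγ hU μ hμ T hT D hD _hbdd
  obtain ⟨s, hs⟩ := hC ω₂ lam β γ hω hl hβ hγ hU μ hμ T hT D hD
  have hso := hSO ω₂ lam β γ hω hl hβ hγ hU μ hμ T hT D hD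
  obtain ⟨c, hc, N₁, hfloor⟩ := hF ω₂ lam β γ hω hl hβ hγ hU μ hμ T hT D hD
  have hs' : Tendsto (cesaro D) atTop (𝓝 s) := hs
  have hlim : Tendsto D atTop (𝓝 s) := tendsto_of_cesaro_of_slowlyOscillating hs' hso
  have hcs : c ≤ s := ge_of_tendsto hlim (eventually_atTop.2 ⟨N₁, hfloor⟩)
  exact ⟨s, lt_of_lt_of_le hc hcs, hlim⟩

/-- The same composition for the bet route's twin. -/
theorem transferKernelPositivity_boundedResponseConverges_of_tauberian :
    CesaroResponse → SlowlyOscillatingResponse → JunctionLocality.ConductanceLowerBound →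
      TransferKernelPositivity.BoundedResponseConverges :=
  fun hC hSO hF => boundedResponseConverges_of_tauberian hC hSO hF

/-- NECESSITY of the Cesàro piece modulo `BoundedResponse` (stmt-10924). -/
theorem cesaroResponse_of_boundedResponseConverges
    (hBR : OddSectorIrreversibility.BoundedResponse)
    (h : OddSectorIrreversibility.BoundedResponseConverges) : CesaroResponse := by
  intro ω₂ lam β γ hω hl hβ hγ hU μ hμ T hT D hD
  obtain ⟨k, _hk, hlim⟩ :=
    h ω₂ lam β γ hω hl hβ hγ hU μ hμ T hT D hD (hBR ω₂ lam β γ hω hl hβ hγ hU μ hμ T hT D hD)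
  exact ⟨k, cesaro_tendsto_of_tendsto hlim⟩

/-- NECESSITY of the slow-oscillation piece modulo `BoundedResponse` (stmt-10924). -/
theorem slowlyOscillatingResponse_of_boundedResponseConverges
    (hBR : OddSectorIrreversibility.BoundedResponse)
    (h : OddSectorIrreversibility.BoundedResponseConverges) : SlowlyOscillatingResponse := by
  intro ω₂ lam β γ hω hl hβ hγ hU μ hμ T hT D hD
  obtain ⟨k, _hk, hlim⟩ :=
    h ω₂ lam β γ hω hl hβ hγ hU μ hμ T hT D hD (hBR ω₂ lam β γ hω hl hβ hγ hU μ hμ T hT D hD)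
  exact slowlyOscillating_of_tendsto hlim

/-- The two previously registered length-regularity stubs were SIDEWAYS (not implied by Fourier's
conclusion); the Tauberian pieces are not: convergence alone implies both (no floor, no bound). -/
theorem tauberianPieces_of_convergence (D : ℕ → ℝ) (k : ℝ) (h : Tendsto D atTop (𝓝 k)) :
    Tendsto (cesaro D) atTop (𝓝 k) ∧ SlowlyOscillating D :=
  ⟨cesaro_tendsto_of_tendsto h, slowlyOscillating_of_tendsto h⟩

/-! ## §3 Twin transport of the landed exact split (bet route `TransferKernelPositivity`) -/

/-- The bet route's twin of the shared crux is the same proposition as the OddSector twin. -/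
theorem transferKernelPositivity_twin_iff :
    TransferKernelPositivity.BoundedResponseConverges ↔
      OddSectorIrreversibility.BoundedResponseConverges :=
  Iff.rfl

/-- Split glue for the `TransferKernelPositivity` twin: oscillation excluded (stmt-12238) and
insulation excluded (stmt-11749) give the slot; one line over the landed
`boundedResponseConverges_of_subs` (p137843). -/
theorem transferKernelPositivity_boundedResponseConverges_of_subs :
    BoundaryEscapeDeficit.EscapeNonOscillation → JunctionLocality.ConductanceLowerBound →
      TransferKernelPositivity.BoundedResponseConverges :=
  fun h₁ h₂ => Summit.AtomisticToContinuum.FouriersLaw.Theorems.boundedResponseConverges_of_subs h₁ h₂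

end Summit.AtomisticToContinuum.FouriersLaw.Cruxes.BoundedResponseConverges.StrategistS2
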